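import Literature.Topology.FourManifolds.SphereSurgeryHomology
import Literature.AlgebraicTopology.FundamentalGroup.SphereCoreComplementPi1
import Literature.AlgebraicTopology.FundamentalGroup.SphereSimplyConnected
import Literature.AlgebraicTopology.FundamentalGroupoid.SimplyConnectedComplPoint
import HarnessLib

/-!
# The fundamental group after a surgery of index `≥ 2` (Kosinski X.2.2, `π₁` step)

Topic `Literature/Topology/FourManifolds` (fact seat of
`Literature.Topology.FourManifolds.HomotopySphere.exists_highlyConnected_of_mem_signatureSet`,
brick B4b).  A. Kosinski, *Differential Manifolds* (1993), Ch. X §2, proof of Thm. (2.2),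
p. 201: a surgery on a `k`-sphere with `k ≥ 2` and cosphere dimension `l ≥ 2` in a simply
connected manifold yields a simply connected manifold.  Proof (Seifert–van Kampen,
Hatcher 2002, Thm. 1.20 / Lemma 1.15): `P = jA(X ∖ S) ∪ jB(OD^{k+1} × Sˡ)` with
`π₁(X ∖ S) = π₁(X) = 1` (`SphereCoreComplementPi1`: the normal fibre `ℝˡ⁺¹`, `l + 1 ≥ 3`, has
simply connected puncture), `π₁(OD × Sˡ) = π₁(Sˡ) = 1` (`l ≥ 2`), and connected intersection
`Sᵏ × (Bˡ⁺¹ ∖ 0)`.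

* `FramedSphereFamily.simplyConnectedSpace_complement_iff` — `X ∖ S` is simply connected iff `X`
  is (`l ≥ 2`, `k ≥ 1`);
* `FramedSphereFamily.surjective_inclHom_range_jA` — `π₁(jA(X ∖ S)) → π₁(P)` is onto (`l ≥ 2`);
* `FramedSphereFamily.simplyConnectedSpace_of_surgery` — `X` simply connected, `k ≥ 1`, `l ≥ 2`
  `⟹ P` simply connected.

Everything is proved; no new definitions, no named facts.  Spaces live in `Type` as in
`SphereSurgeryHomology`.

## References

* A. Kosinski, *Differential Manifolds* (1993), Ch. X §2, Thm. (2.2) (proof, p. 201).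
  [Kosinski1993]
* A. Hatcher, *Algebraic Topology* (2002), Thm. 1.20, Lemma 1.15. [HatcherAT2002]
-/

noncomputable section

open scoped Manifold ContDiff Topology ContinuousMap
open Set Function Metric Topology
open Literature.AlgebraicTopology.FundamentalGroup
open Literature.AlgebraicTopology.FundamentalGroup.VanKampen
open Literature.AlgebraicTopology.SingularHomology (pathConnectedSpace_sphere)
open Literature.AlgebraicTopology.FundamentalGroupoid
  (isSimplyConnected_compl_singleton_of_isOpenEmbedding)

namespace Literature.Topology.FourManifolds

namespace FramedSphereFamily

variable {EX HX : Type*} [NormedAddCommGroup EX] [NormedSpace ℝ EX] [TopologicalSpace HX]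
  {IX : ModelWithCorners ℝ EX HX} {X : Type} [TopologicalSpace X] [ChartedSpace HX X] [T2Space X]
  {ι : Type} [Unique ι] {k l : ℕ} (ν : FramedSphereFamily IX X ι k (l + 1))
  {P : Type} [TopologicalSpace P] {jA : ↥ν.complement → P} {jB : ↥(ballTimesSphere ι k l) → P}

/-- `ℝˡ⁺¹ ∖ 0` is simply connected for `l ≥ 2`. [cite: HatcherAT2002, Prop. 1.14] -/
theorem simplyConnectedSpace_compl_zero (hl : 2 ≤ l) :
    SimplyConnectedSpace ↥(({0} : Set (EuclideanSpace ℝ (Fin (l + 1))))ᶜ) := by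
  have h := isSimplyConnected_compl_singleton_of_isOpenEmbedding
    (M := EuclideanSpace ℝ (Fin (l + 1))) (i := id) IsOpenEmbedding.id
    (by rw [finrank_euclideanSpace, Fintype.card_fin]; omega)
  exact h

/-- **`X ∖ S` is simply connected iff `X` is**, for the (unique) framed `k`-sphere `S` of the
family with normal fibre `ℝˡ⁺¹`, `l ≥ 2`, `k ≥ 1` (`SphereCoreComplementPi1`).
[cite: Kosinski1993, Ch. X §2, Thm. 2.2 (proof)] -/
theorem simplyConnectedSpace_complement_iff [PathConnectedSpace X] (hk : 1 ≤ k) (hl : 2 ≤ l) :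
    SimplyConnectedSpace ↥ν.complement ↔ SimplyConnectedSpace X := by
  haveI := pathConnectedSpace_sphere (n := k) (by omega)
  haveI := simplyConnectedSpace_compl_zero hl
  have h := simplyConnectedSpace_compl_core_iff (Z := (Metric.sphere (0 : EuclideanSpace ℝ (Fin (k
      + 1)))
      1)) (E := EuclideanSpace ℝ (Fin (l + 1))) (W := X)
    (φ := ν.toFun default) (ν.isOpenEmbedding_toFun default)
  have hset : (ν.toFun default '' (univ ×ˢ ({0} : Set (EuclideanSpace ℝ (Fin (l + 1))))))ᶜ =
      (ν.complement : Set X) := (coe_complement_eq ν).symm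
  rw [← h]
  exact (Homeomorph.setCongr hset.symm).toHomotopyEquiv.simplyConnectedSpace_iff

/-- The handle `ι × OD^{k+1} × Sˡ` of a one-sphere family is simply connected for `l ≥ 2`.
[cite: HatcherAT2002, Prop. 1.12, Prop. 1.14] -/
theorem simplyConnectedSpace_ballTimesSphere (ι : Type) [Unique ι] (k : ℕ) (hl : 2 ≤ l) :
    SimplyConnectedSpace ↥(ballTimesSphere ι k l) := by
  haveI : ContractibleSpace (ball (0 : EuclideanSpace ℝ (Fin (k + 1))) 1) :=
    (convex_ball (0 : EuclideanSpace ℝ (Fin (k + 1))) 1).contractibleSpace ⟨0, mem_ball_self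
        one_pos⟩
  haveI : SimplyConnectedSpace ((Metric.sphere (0 : EuclideanSpace ℝ (Fin (l + 1))) 1)) :=
    Literature.AlgebraicTopology.FundamentalGroup.simplyConnectedSpace_euclideanSphere l hl
  obtain ⟨hv⟩ := ContractibleSpace.hequiv_unit (ball (0 : EuclideanSpace ℝ (Fin (k + 1))) 1)
  have e2 : (↥(ball (0 : EuclideanSpace ℝ (Fin (k + 1))) 1) × ((Metric.sphere (0 : EuclideanSpace ℝ
      (Fin (l + 1))) 1))) ≃ₕ (Unit × ((Metric.sphere (0 : EuclideanSpace ℝ (Fin (l + 1))) 1))) :=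
    hv.prodCongr (ContinuousMap.HomotopyEquiv.refl _)
  have e3 : (Unit × ((Metric.sphere (0 : EuclideanSpace ℝ (Fin (l + 1))) 1))) ≃ₜ
      ((Metric.sphere (0 : EuclideanSpace ℝ (Fin (l + 1))) 1)) := Homeomorph.punitProd _
  have e := ((ballTimesSphereHomeomorph ι k l).toHomotopyEquiv.trans e2).trans e3.toHomotopyEquiv
  exact e.simplyConnectedSpace_iff.2 inferInstance

variable {ν}
variable (hA : IsOpenEmbedding jA) (hB : IsOpenEmbedding jB) (hcov : range jA ∪ range jB = univ)
  (hrel : ∀ a b, jA a = jB b ↔ sphereFamilySurgeryRel ν a b)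

/-- A base point in the glued part: `φ(u₀, ½ e₀)`. [folklore] -/
theorem exists_mem_gluedPart : ∃ a : ↥ν.complement, a ∈ ν.gluedPart := by
  let u₀ : (Metric.sphere (0 : EuclideanSpace ℝ (Fin (k + 1))) 1) := Classical.arbitrary _
  let w₀ : EuclideanSpace ℝ (Fin (l + 1)) := (2⁻¹ : ℝ) • EuclideanSpace.single 0 1
  have hw₀ : w₀ ≠ 0 ∧ ‖w₀‖ < 1 := by
    constructor
    · intro h
      have : ‖w₀‖ = 2⁻¹ := by simp [w₀, norm_smul]
      rw [h, norm_zero] at this; norm_num at this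
    · simp [w₀, norm_smul]; norm_num
  exact ⟨⟨ν.toFun default (u₀, w₀), ν.apply_mem_complement_of_mem default hw₀⟩,
    ⟨(u₀, w₀), hw₀, rfl⟩⟩

include hA hrel in
/-- The intersection of the two pieces is path connected (`k, l ≥ 1`). [folklore] -/
theorem isPathConnected_range_inter_range (hk : 1 ≤ k) (hl : 1 ≤ l) :
    IsPathConnected (range jA ∩ range jB) := by
  rw [range_inter_range_eq hrel]
  haveI : PathConnectedSpace ↥(puncturedUnitTube k l) :=
    isPathConnected_iff_pathConnectedSpace.1 (isPathConnected_puncturedUnitTube hk hl)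
  haveI : PathConnectedSpace ↥ν.gluedPart :=
    ν.gluedPartHomeomorph.surjective.pathConnectedSpace ν.gluedPartHomeomorph.continuous
  exact (isPathConnected_iff_pathConnectedSpace.2 ‹PathConnectedSpace ↥ν.gluedPart›).image
    hA.continuous

omit [TopologicalSpace P] in
include hrel in
/-- A point of `jA(glued part)` lies in `range jB`. [folklore] -/
theorem apply_mem_range_jB {a₀ : ↥ν.complement} (ha₀ : a₀ ∈ ν.gluedPart) : jA a₀ ∈ range jB := by
  have : jA a₀ ∈ range jA ∩ range jB := by
    rw [range_inter_range_eq hrel]; exact ⟨a₀, ha₀, rfl⟩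
  exact this.2

include hA hB hcov hrel in
/-- **`π₁(jA(X ∖ S)) → π₁(P)` is onto** for a one-sphere surgery gluing with `k ≥ 1`, `l ≥ 2`
and `X ∖ S` path connected (van Kampen generation, Hatcher Lemma 1.15, with
`π₁(OD^{k+1} × Sˡ) = 1`). [cite: Kosinski1993, Ch. X §2, Thm. 2.2 (proof)] -/
theorem surjective_inclHom_range_jA [PathConnectedSpace ↥ν.complement] (hk : 1 ≤ k) (hl : 2 ≤ l)
    {a₀ : ↥ν.complement} (ha₀ : a₀ ∈ ν.gluedPart) :
    Function.Surjective (inclHom (range jA) (jA a₀) (mem_range_self a₀)) := by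
  have hxT : jA a₀ ∈ range jB := apply_mem_range_jB hrel ha₀
  haveI := simplyConnectedSpace_ballTimesSphere ι k hl
  have hUpc : IsPathConnected (range jA) := isPathConnected_range hA.continuous
  have hTpc : IsPathConnected (range jB) := isPathConnected_range hB.continuous
  have hmeet := isPathConnected_range_inter_range hA hrel hk (by omega)
  have hgen := closure_range_inclHom_union_eq_top hA.isOpen_range hB.isOpen_range hcov
    (mem_range_self a₀) hxT hUpc hTpc hmeet
  haveI : SimplyConnectedSpace ↥(range jB) :=
    hB.isEmbedding.toHomeomorph.toHomotopyEquiv.simplyConnectedSpace_iff.1 inferInstance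
  rw [← MonoidHom.range_eq_top, ← top_le_iff, ← hgen, Subgroup.closure_le, MonoidHom.coe_range]
  rintro b (hb | ⟨a, rfl⟩)
  · exact hb
  · rw [Subsingleton.elim a 1, map_one]
    exact ⟨1, map_one _⟩

include hA hB hcov hrel in
/-- **Surgery of index `k + 1 ≥ 2` with cosphere `Sˡ`, `l ≥ 2`, preserves simple connectivity**
(Kosinski 1993, X.2, proof of Thm. (2.2), p. 201): if `X` is simply connected then so is the
glued space `P = jA(X ∖ S) ∪ jB(OD^{k+1} × Sˡ)` (`π₁(X ∖ S) = π₁(X) = 1` since the normal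
fibre `ℝˡ⁺¹` has simply connected puncture, `π₁(OD × Sˡ) = 1`, van Kampen).
[cite: Kosinski1993, Ch. X §2, Thm. 2.2 (proof)] -/
theorem simplyConnectedSpace_of_surgery [SimplyConnectedSpace X] (hk : 1 ≤ k) (hl : 2 ≤ l) :
    SimplyConnectedSpace P := by
  haveI : SimplyConnectedSpace ↥ν.complement :=
    (ν.simplyConnectedSpace_complement_iff hk hl).2 inferInstance
  obtain ⟨a₀, ha₀⟩ := exists_mem_gluedPart (ν := ν)
  have hxT : jA a₀ ∈ range jB := apply_mem_range_jB hrel ha₀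
  have hsurj := surjective_inclHom_range_jA hA hB hcov hrel hk hl ha₀
  haveI : SimplyConnectedSpace ↥(range jA) :=
    hA.isEmbedding.toHomeomorph.toHomotopyEquiv.simplyConnectedSpace_iff.1 inferInstance
  haveI : Subsingleton (_root_.FundamentalGroup P (jA a₀)) :=
    ⟨fun a b ↦ by
      obtain ⟨a', rfl⟩ := hsurj a
      obtain ⟨b', rfl⟩ := hsurj b
      rw [Subsingleton.elim a' b']⟩
  haveI := simplyConnectedSpace_ballTimesSphere ι k hl
  haveI : PathConnectedSpace P := by
    rw [pathConnectedSpace_iff_univ, ← hcov]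
    exact (isPathConnected_range hA.continuous).union (isPathConnected_range hB.continuous)
      ⟨jA a₀, mem_range_self _, hxT⟩
  exact simplyConnectedSpace_of_subsingleton (jA a₀)

end FramedSphereFamily

end Literature.Topology.FourManifolds
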